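import Mathlib
import Summits.ValiantsHypothesis.ValiantsHypothesis.Theorems.MonotoneRestorationOrbitRestorationQPWildResidue
import Summits.ValiantsHypothesis.ValiantsHypothesis.Theorems.MonotoneRestorationOrbitRestorationQPRestorable
import Summits.ValiantsHypothesis.ValiantsHypothesis.Theorems.MonotoneRestorationOrbitRestorationQPRowColumnDerivativeConverse
import Summits.ValiantsHypothesis.ValiantsHypothesis.Theorems.MonotoneRestorationOrbitRestorationQPRowColumnWreath
import Summits.ValiantsHypothesis.ValiantsHypothesis.Theorems.MonotoneRestorationOrbitRestorationQPTranspose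
import HarnessLib

/-!
# Route MonotoneRestoration — crux `OrbitRestorationQP` (stmt-ValiantsHypothesis-18293), line `depth-three-rung`:
# the wild residue of `A_∞` may assume the polynomial lies OUTSIDE the row/column strata

`Theorems/…WildResidue.lean` reduces the registered stub `stub_sigmaPiSigmaValue` (A_∞) BY NAME to `WildResidue (fun _ => 0)`:
restore every matrix-symmetric `p ∈ PDClass (fun _ => 1) n c` that has no groupable depth-three representation.  The strata landed
since — `ℂ[r, c]` in TEST form (`RowColumnDerivativeConverse.qpOrbitRestorable_of_forall_ddiffDeriv_eq_zero`, `c = 9`) and the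
WREATH stratum (`RowColumnWreath.qpOrbitRestorable_of_rowwise_symmetric`, `c = 12`) — are statements about `p` itself, not about
a representation, so they can be removed from the residue as HYPOTHESES available to whoever attacks it:

* `wildResidue_zero_of_sharp` — **SHARPER RESIDUE ⇒ RESIDUE**: it suffices to restore the matrix-symmetric `p ∈ PDClass 1 n c`
  without groupable representation that are (i) NOT killed by some double-difference derivation `∂_{ab} − ∂_{a'b} − ∂_{ab'} +
  ∂_{a'b'}` (i.e. `p ∉ ℂ[r, c]`, equivalently every admissible space of affine forms of `p` contains all `(n−1)²` double
  differences, `…RowColumnEssential.lean`) and (ii) NOT invariant under the permutations of the entries inside some row;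
* `sigmaPiSigmaValue_of_sharpResidue` — hence the sharper residue implies A_∞ (conclusion = the registered stub verbatim).

Calibration: bookkeeping over landed theorems (no new mathematics); records in the kernel that the residue-prover may assume (i)
and (ii).  Conjecture-grade residue of a conjecture-grade rung; nothing here bears on VP ≠ VNP. [folklore]
[cite: DawarWilsenach2025, §3.3]
-/

noncomputable section

open scoped Classical

-- `Summit.ValiantsHypothesis.ValiantsHypothesis.…` is the tree's single-conjunct layout (Sub = Summit).
set_option linter.dupNamespace false

namespace Summit.ValiantsHypothesis.ValiantsHypothesis.Theorems.OrbitRestorationQPDepthThreeRung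

namespace WildResidueSharp

open MvPolynomial Equiv Literature.Computability.AlgebraicComplexity

/-- **SHARPER RESIDUE ⇒ WILD RESIDUE (budget `0`).**  If, for every `c`, some `c'` restores every matrix-symmetric
`p ∈ PDClass (fun _ => 1) n c` without groupable representation which is moreover NOT killed by some double-difference derivation
and NOT invariant under the within-row permutations of some row, then `WildResidue (fun _ => 0)` holds: the two excluded cases
are the `ℂ[r, c]` stratum (`c' = 9`) and the wreath stratum (`c' = 12`). [folklore] -/
theorem wildResidue_zero_of_sharp
    (hW : ∀ c : ℕ, ∃ c' : ℕ, ∀ (n : ℕ) (p : MvPolynomial (Fin n × Fin n) ℂ),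
      (∀ σ τ : Perm (Fin n), rename (fun q : Fin n × Fin n => (σ q.1, τ q.2)) p = p) →
      PDClass (fun _ => 1) n c p → ¬ GroupableUpTo 0 n c p →
      (∃ a a' b b' : Fin n, pderiv (a, b) p - pderiv (a', b) p - pderiv (a, b') p + pderiv (a', b') p ≠ 0) →
      (∃ (i : Fin n) (τ : Perm (Fin n)),
        rename (fun q : Fin n × Fin n => if q.1 = i then (q.1, τ q.2) else q) p ≠ p) →
      QPOrbitRestorable c' n p) :
    WildResidue fun _ => 0 := by
  intro c
  obtain ⟨c', hc'⟩ := hW c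
  refine ⟨max c' 12, fun n p hsym hPD hng => ?_⟩
  by_cases hD : ∀ a a' b b' : Fin n, pderiv (a, b) p - pderiv (a', b) p - pderiv (a, b') p + pderiv (a', b') p = 0
  · exact Restorable.qpOrbitRestorable_mono (le_max_of_le_right (by norm_num))
      (RowColumnDerivativeConverse.qpOrbitRestorable_of_forall_ddiffDeriv_eq_zero hsym hD)
  by_cases hrow : ∀ (i : Fin n) (τ : Perm (Fin n)),
      rename (fun q : Fin n × Fin n => if q.1 = i then (q.1, τ q.2) else q) p = p
  · exact Restorable.qpOrbitRestorable_mono (le_max_right _ _)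
      (RowColumnWreath.qpOrbitRestorable_of_rowwise_symmetric hsym hrow)
  push Not at hD hrow
  exact Restorable.qpOrbitRestorable_mono (le_max_left _ _) (hc' n p hsym hPD hng hD hrow)

/-- **SHARPER RESIDUE ⇒ `A_∞`.**  The registered stub `stub_sigmaPiSigmaValue` (conclusion verbatim) follows from the sharper
residue, by `WildResidueThms.sigmaPiSigmaValue_of_wildResidue_zero`. [folklore] -/
theorem sigmaPiSigmaValue_of_sharpResidue
    (hW : ∀ c : ℕ, ∃ c' : ℕ, ∀ (n : ℕ) (p : MvPolynomial (Fin n × Fin n) ℂ),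
      (∀ σ τ : Perm (Fin n), rename (fun q : Fin n × Fin n => (σ q.1, τ q.2)) p = p) →
      PDClass (fun _ => 1) n c p → ¬ GroupableUpTo 0 n c p →
      (∃ a a' b b' : Fin n, pderiv (a, b) p - pderiv (a', b) p - pderiv (a, b') p + pderiv (a', b') p ≠ 0) →
      (∃ (i : Fin n) (τ : Perm (Fin n)),
        rename (fun q : Fin n × Fin n => if q.1 = i then (q.1, τ q.2) else q) p ≠ p) →
      QPOrbitRestorable c' n p) :
    ∀ f : (n : ℕ) → MvPolynomial (Fin n × Fin n) ℂ, IsMatrixSymmetric f →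
      (∃ c : ℕ, ∀ n : ℕ, PDClass (fun _ => 1) n c (f n)) →
      ∃ c : ℕ, ∀ n : ℕ, QPOrbitRestorable c n (f n) :=
  WildResidueThms.sigmaPiSigmaValue_of_wildResidue_zero (wildResidue_zero_of_sharp hW)

/-- **The same sharpening for any budget `K`** (the form used with `depthThree_rankBound`, `…WildResidue.lean`):
`WildResidue K` follows from its restriction to polynomials outside the `ℂ[r, c]` and wreath strata. [folklore] -/
theorem wildResidue_of_sharp (K : ℕ → ℕ)
    (hW : ∀ c : ℕ, ∃ c' : ℕ, ∀ (n : ℕ) (p : MvPolynomial (Fin n × Fin n) ℂ),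
      (∀ σ τ : Perm (Fin n), rename (fun q : Fin n × Fin n => (σ q.1, τ q.2)) p = p) →
      PDClass (fun _ => 1) n c p → ¬ GroupableUpTo (K c) n c p →
      (∃ a a' b b' : Fin n, pderiv (a, b) p - pderiv (a', b) p - pderiv (a, b') p + pderiv (a', b') p ≠ 0) →
      (∃ (i : Fin n) (τ : Perm (Fin n)),
        rename (fun q : Fin n × Fin n => if q.1 = i then (q.1, τ q.2) else q) p ≠ p) →
      QPOrbitRestorable c' n p) :
    WildResidue K := by
  intro c
  obtain ⟨c', hc'⟩ := hW c
  refine ⟨max c' 12, fun n p hsym hPD hng => ?_⟩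
  by_cases hD : ∀ a a' b b' : Fin n, pderiv (a, b) p - pderiv (a', b) p - pderiv (a, b') p + pderiv (a', b') p = 0
  · exact Restorable.qpOrbitRestorable_mono (le_max_of_le_right (by norm_num))
      (RowColumnDerivativeConverse.qpOrbitRestorable_of_forall_ddiffDeriv_eq_zero hsym hD)
  by_cases hrow : ∀ (i : Fin n) (τ : Perm (Fin n)),
      rename (fun q : Fin n × Fin n => if q.1 = i then (q.1, τ q.2) else q) p = p
  · exact Restorable.qpOrbitRestorable_mono (le_max_right _ _)
      (RowColumnWreath.qpOrbitRestorable_of_rowwise_symmetric hsym hrow)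
  push Not at hD hrow
  exact Restorable.qpOrbitRestorable_mono (le_max_left _ _) (hc' n p hsym hPD hng hD hrow)


/-! ### Three excluded strata: `ℂ[r, c]`, row wreath, column wreath -/

/-- **SHARPER RESIDUE, THREE EXCLUSIONS ⇒ WILD RESIDUE (any budget `K`).**  With the transpose tool
(`Transpose.qpOrbitRestorable_of_colwise_symmetric`, `c' = 15`) the residue-prover may in addition assume that `p` is NOT
invariant under the within-column permutations of some column. [folklore] -/
theorem wildResidue_of_sharp₃ (K : ℕ → ℕ)
    (hW : ∀ c : ℕ, ∃ c' : ℕ, ∀ (n : ℕ) (p : MvPolynomial (Fin n × Fin n) ℂ),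
      (∀ σ τ : Perm (Fin n), rename (fun q : Fin n × Fin n => (σ q.1, τ q.2)) p = p) →
      PDClass (fun _ => 1) n c p → ¬ GroupableUpTo (K c) n c p →
      (∃ a a' b b' : Fin n, pderiv (a, b) p - pderiv (a', b) p - pderiv (a, b') p + pderiv (a', b') p ≠ 0) →
      (∃ (i : Fin n) (τ : Perm (Fin n)),
        rename (fun q : Fin n × Fin n => if q.1 = i then (q.1, τ q.2) else q) p ≠ p) →
      (∃ (j : Fin n) (τ : Perm (Fin n)),
        rename (fun q : Fin n × Fin n => if q.2 = j then (τ q.1, q.2) else q) p ≠ p) →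
      QPOrbitRestorable c' n p) :
    WildResidue K := by
  intro c
  obtain ⟨c', hc'⟩ := hW c
  refine ⟨max c' 15, fun n p hsym hPD hng => ?_⟩
  by_cases hD : ∀ a a' b b' : Fin n, pderiv (a, b) p - pderiv (a', b) p - pderiv (a, b') p + pderiv (a', b') p = 0
  · exact Restorable.qpOrbitRestorable_mono (le_max_of_le_right (by norm_num))
      (RowColumnDerivativeConverse.qpOrbitRestorable_of_forall_ddiffDeriv_eq_zero hsym hD)
  by_cases hrow : ∀ (i : Fin n) (τ : Perm (Fin n)),
      rename (fun q : Fin n × Fin n => if q.1 = i then (q.1, τ q.2) else q) p = p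
  · exact Restorable.qpOrbitRestorable_mono (le_max_of_le_right (by norm_num))
      (RowColumnWreath.qpOrbitRestorable_of_rowwise_symmetric hsym hrow)
  by_cases hcol : ∀ (j : Fin n) (τ : Perm (Fin n)),
      rename (fun q : Fin n × Fin n => if q.2 = j then (τ q.1, q.2) else q) p = p
  · exact Restorable.qpOrbitRestorable_mono (le_max_right _ _)
      (Transpose.qpOrbitRestorable_of_colwise_symmetric hsym hcol)
  push Not at hD hrow hcol
  exact Restorable.qpOrbitRestorable_mono (le_max_left _ _) (hc' n p hsym hPD hng hD hrow hcol)

/-- **SHARPER RESIDUE, THREE EXCLUSIONS ⇒ `A_∞`** (budget `0`, conclusion = the registered stub verbatim). [folklore] -/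
theorem sigmaPiSigmaValue_of_sharpResidue₃
    (hW : ∀ c : ℕ, ∃ c' : ℕ, ∀ (n : ℕ) (p : MvPolynomial (Fin n × Fin n) ℂ),
      (∀ σ τ : Perm (Fin n), rename (fun q : Fin n × Fin n => (σ q.1, τ q.2)) p = p) →
      PDClass (fun _ => 1) n c p → ¬ GroupableUpTo 0 n c p →
      (∃ a a' b b' : Fin n, pderiv (a, b) p - pderiv (a', b) p - pderiv (a, b') p + pderiv (a', b') p ≠ 0) →
      (∃ (i : Fin n) (τ : Perm (Fin n)),
        rename (fun q : Fin n × Fin n => if q.1 = i then (q.1, τ q.2) else q) p ≠ p) →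
      (∃ (j : Fin n) (τ : Perm (Fin n)),
        rename (fun q : Fin n × Fin n => if q.2 = j then (τ q.1, q.2) else q) p ≠ p) →
      QPOrbitRestorable c' n p) :
    ∀ f : (n : ℕ) → MvPolynomial (Fin n × Fin n) ℂ, IsMatrixSymmetric f →
      (∃ c : ℕ, ∀ n : ℕ, PDClass (fun _ => 1) n c (f n)) →
      ∃ c : ℕ, ∀ n : ℕ, QPOrbitRestorable c n (f n) :=
  WildResidueThms.sigmaPiSigmaValue_of_wildResidue_zero (wildResidue_of_sharp₃ (fun _ => 0) hW)

end WildResidueSharp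

end Summit.ValiantsHypothesis.ValiantsHypothesis.Theorems.OrbitRestorationQPDepthThreeRung

end
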